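import Summits.BirchSwinnertonDyer.BirchSwinnertonDyer.Theorems.PrintCf2RubinValueTwoRowTwoClassFrame
import Summits.BirchSwinnertonDyer.BirchSwinnertonDyer.Theorems.PrintCf2RubinValueTwoTwistedKatoKummerLevels
import Literature.NumberTheory.NumberFields.ConductorLocalCriterion
import HarnessLib

/-!
# M-LINE-PIN / (α3) ROW 2, FILE 8m: THE IDEAL OF RECORD `𝔣 = 𝔣(K₀|K)` — Neukirch's conductor of `K₀ = K_θ′` serves ROW 2 (`hNK₀`, `hram0`),
# the print F1 (`θ′` trivial on `Gal(K̄/K(𝔣))`) and hCZ (`K₀ ⊆ K(2^s 𝔣)`) AT ONCE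

Cell `bsd-print-cf2`, WIDTH seat `bsd-line-cf2-p1-w6` g10 (prover-bsd-line-cf2-p1-w6-g10-0), (α3) ROW 2 of the JLK road on the DECIDING child
stmt-BirchSwinnertonDyer-24721 `PrintCf2RubinValueTwo.MainConjClauseAtSplitTwoQuadDA`; `--supports` that item (helper, Theses-free).
HONEST FRAMING: Galois/class-field bookkeeping on tree theorems (-w2 g19 `TameConductor.…` for ANY ideal whose tame support is the ramification set;
the tree's conductor `NumberFields.conductor` with `conductor_le_iff_not_isUnramifiedIn`, `le_rayClassField_conductor`; `isUnramifiedIn_iff_forall_inertia_…`;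
`TwistedZeta.rayClassField_le_katoLayer`). Nothing here closes the crux or a registered stub; no summit statement is proved by this seat; BSD is not
proved by any of this. THEOREMS ONLY (no definition, no named fact, no instance, no `sorry`).

WHY. The supplier of `stub_classGroupHalf` must choose ONE ideal `𝔣` for the JLK carriers: ROW 2 (FILE 8l `RowTwo.exists_charIdeal_mul_pow_eq_of_class`)
wants `hNK₀ : ramificationSubgroup K (suppPF 2 𝔣) ≤ galFixing K K₀` and `hram0` («every `u ∤ 2` in `suppPF 2 𝔣` is ramified for `θ′`»); the print F1
`JohnsonLeungKings2011.cor53_thm52Shape` wants `θ′` trivial on `absGaloisFixingSubgroup (rayClassField K 𝔣)`; hCZ (-w6 g18 `KatoZetaEllClosure.…`) wants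
`K₀ ≤ katoLayer 2 𝔣 s₁`. -w2 g19's (C-e) tame ideal `𝔣₀` (prime to `2`) serves the first two but NOT the last two when `θ′` is ramified above `2`.
The conductor `𝔣 := 𝔣(K₀|K)` serves all four: its prime divisors are EXACTLY the places where `θ′|_{I_u} ≠ 1` (tame or wild).

* §1 (`θ′ : Γ_K → ℤ_pˣ` with `ker θ′ = Gal(K̄/K₀)`, `K₀/K` finite abelian): `dvd_conductor_iff_exists_mem_inertia_apply_ne_one` (`u ∣ 𝔣(K₀|K) ↔ ∃ δ ∈ I_u,
  θ′ δ ≠ 1`, ALL `u`), `ramificationSubgroup_suppPF_conductor_le_galFixing` (`hNK₀`), `exists_mem_inertia_apply_ne_one_of_mem_suppPF_conductor` (`hram0`),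
  `apply_eq_one_of_mem_galFixing_rayClassField_conductor` / `…_absGaloisFixingSubgroup_…` (F1's `hθ𝔣`), `le_katoLayer_conductor` (hCZ's `hK₀`, every `s`).
* §2 `conductor_frame_of_class` — the package on the class frame of `stub_classGroupHalf` (`θ` quadratic, `K₀ = K_θ`, `θ′ = unitChar θ`, `p = 2`,
  `K` imaginary quadratic), `hram0` also in the `= −1` form.

References: J. Neukirch, *Algebraic Number Theory* (1999) Ch. VI §6 (6.4)–(6.6), Ch. VII §10 (10.6); J. Johnson-Leung, G. Kings, J. reine angew. Math.
653 (2011) §4 Lemma 4.3, Cor. 5.3; K. Kato, Astérisque 295 (2004) §15.1.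
-/

noncomputable section

open scoped Classical

-- the summit namespace `Summit.BirchSwinnertonDyer.BirchSwinnertonDyer` repeats the problem name by design (D-0017)
set_option linter.dupNamespace false
set_option autoImplicit false

open scoped NumberField
open Field IsDedekindDomain IntermediateField NumberField
open Literature.NumberTheory Literature.NumberTheory.NumberFields
open Literature.NumberTheory.GaloisRepresentations Literature.NumberTheory.GaloisRepresentations.LocalWeilDatum
open Literature.NumberTheory.EllipticCurves Literature.NumberTheory.EllipticCurves.GreenbergSelmer
open Literature.NumberTheory.ComplexMultiplication.EllipticUnits
open Literature.NumberTheory.ComplexMultiplication.EllipticUnits.JohnsonLeungKings2011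
open Literature.NumberTheory.EllipticCurves.KellerYin2024
open Summit.BirchSwinnertonDyer.BirchSwinnertonDyer.Theorems.PrintCf2

namespace Summit.BirchSwinnertonDyer.BirchSwinnertonDyer.Theorems.PrintCf2.ConductorOfRecord

/-! ## §1. The conductor of `K₀ = K_θ′` -/

section General

variable {K : Type} [Field K] [NumberField K] {p : ℕ} [Fact p.Prime] (θ' : absoluteGaloisGroup K →ₜ* ℤ_[p]ˣ)
  (K₀ : IntermediateField K (AlgebraicClosure K)) [NumberField K₀] [FiniteDimensional K K₀] [IsAbelianGalois K K₀]

/-- **`u ∣ 𝔣(K₀|K) ⟺ θ′|_{I_u} ≠ 1`** for `ker θ′ = Gal(K̄/K₀)` (every place `u`, tame or wild): `u ∣ 𝔣 ⟺ u` ramifies in `K₀` ((6.6),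
`conductor_le_iff_not_isUnramifiedIn`) `⟺` some inertia group above `u` survives in `Gal(K₀/K)` (`isUnramifiedIn_iff_forall_inertia_absRestrictNormalHom_eq_one`)
`⟺` (conjugating to the pinned prime `𝔓₀ = adicCompletionPrime K u`, `θ′` being a class function) `∃ δ ∈ I_u, θ′ δ ≠ 1`.
[cite: NeukirchANT1999, Ch. VI §6 Cor. (6.6) p. 399; Ch. VII §10 Thm. (10.6) (proof)] -/
theorem dvd_conductor_iff_exists_mem_inertia_apply_ne_one (hθ'K₀ : ∀ σ ∈ galFixing K K₀, θ' σ = 1)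
    (hG₀ : ∀ σ : absoluteGaloisGroup K, θ' σ = 1 → σ ∈ galFixing K K₀) (u : HeightOneSpectrum (𝓞 K)) :
    u.asIdeal ∣ NumberFields.conductor K₀ ↔ ∃ δ ∈ inertia u, θ' δ ≠ 1 := by
  haveI : IsGalois K K₀ := IsAbelianGalois.toIsGalois
  rw [Ideal.dvd_iff_le, conductor_le_iff_not_isUnramifiedIn K₀ u, isUnramifiedIn_iff_forall_inertia_absRestrictNormalHom_eq_one K₀ u]
  constructor
  · intro h
    push Not at h
    obtain ⟨𝔓, h𝔓, g, hg, hne⟩ := h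
    -- conjugate `𝔓 = τ • 𝔓₀`
    obtain ⟨τ, rfl⟩ := HeightOneSpectrum.exists_smul_eq_of_mem_primesAbove_holds (adicCompletionPrime_mem_primesAbove K u) h𝔓
    have hg_eq : g = τ * (τ⁻¹ * g * τ) * τ⁻¹ := by group
    have hg' : τ⁻¹ * g * τ ∈ (adicCompletionPrime K u).inertia (absoluteGaloisGroup K) := by
      rwa [← Ideal.conj_mem_inertia_smul_iff (adicCompletionPrime K u) τ, ← hg_eq]
    have hmem : τ⁻¹ * g * τ ∈ inertia u := by
      change τ⁻¹ * g * τ ∈ (absInertia (u.adicCompletion K)).map (absGaloisRestrict K (u.adicCompletion K)).toMonoidHom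
      rw [← inertia_adicCompletionPrime_eq_map_absInertia]
      exact hg'
    refine ⟨τ⁻¹ * g * τ, hmem, fun h1 ↦ hne ?_⟩
    -- `θ′ g = θ′ (τ⁻¹ g τ) = 1`, so `g` fixes `K₀`
    have h1' : θ' g = 1 := by
      rw [map_mul, map_mul, map_inv, mul_comm (θ' τ)⁻¹, mul_assoc, inv_mul_cancel, mul_one] at h1
      exact h1
    rw [absRestrictNormalHom_eq_one_iff_forall_smul]
    intro x
    exact (mem_galFixing_iff K).mp (hG₀ g h1') x x.2
  · rintro ⟨δ, hδ, hne⟩ hunr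
    have hδ' : δ ∈ (adicCompletionPrime K u).inertia (absoluteGaloisGroup K) := by
      rw [inertia_adicCompletionPrime_eq_map_absInertia]
      exact hδ
    have h1 := hunr _ (adicCompletionPrime_mem_primesAbove K u) δ hδ'
    rw [absRestrictNormalHom_eq_one_iff_forall_smul] at h1
    exact hne (hθ'K₀ δ ((mem_galFixing_iff K).mpr fun x hx ↦ h1 ⟨x, hx⟩))

/-- **`hNK₀` at the conductor: `ramificationSubgroup K (suppPF p 𝔣(K₀|K)) ≤ Gal(K̄/K₀)`** (-w2 g19's `TameConductor.ramificationSubgroup_suppPF_le_galFixing`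
for an ideal divisible by every ramified `u ∤ p`). [cite: NeukirchSchmidtWingberg2008, VIII §3] [cite: NeukirchANT1999, Ch. VI §6 (6.6)] -/
theorem ramificationSubgroup_suppPF_conductor_le_galFixing (hθ'K₀ : ∀ σ ∈ galFixing K K₀, θ' σ = 1)
    (hG₀ : ∀ σ : absoluteGaloisGroup K, θ' σ = 1 → σ ∈ galFixing K K₀) :
    ramificationSubgroup K (JohnsonLeungKings2011.suppPF p (NumberFields.conductor K₀)) ≤ galFixing K K₀ :=
  TameConductor.ramificationSubgroup_suppPF_le_galFixing θ' K₀ hθ'K₀ hG₀ fun u _ h ↦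
    (dvd_conductor_iff_exists_mem_inertia_apply_ne_one θ' K₀ hθ'K₀ hG₀ u).mpr h

/-- **`hram0` at the conductor**: every `u ∈ suppPF p 𝔣(K₀|K)` prime to `p` carries an inertia element with `θ′ ≠ 1`
(-w2 g19's `TameConductor.exists_mem_inertia_apply_ne_one_of_mem_suppPF`). [cite: JohnsonLeungKings2011, §4 Lemma 4.3] [cite: NeukirchANT1999, Ch. VI §6 (6.6)] -/
theorem exists_mem_inertia_apply_ne_one_of_mem_suppPF_conductor (hθ'K₀ : ∀ σ ∈ galFixing K K₀, θ' σ = 1)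
    (hG₀ : ∀ σ : absoluteGaloisGroup K, θ' σ = 1 → σ ∈ galFixing K K₀) :
    ∀ u ∈ JohnsonLeungKings2011.suppPF p (NumberFields.conductor K₀), ((p : ℕ) : 𝓞 K) ∉ u.asIdeal →
      ∃ δ₀ ∈ inertia u, θ' δ₀ ≠ 1 :=
  TameConductor.exists_mem_inertia_apply_ne_one_of_mem_suppPF θ' fun u _ h ↦
    (dvd_conductor_iff_exists_mem_inertia_apply_ne_one θ' K₀ hθ'K₀ hG₀ u).mp h

/-- **F1's `hθ𝔣` at the conductor: `θ′` is trivial on `Gal(K̄/K(𝔣(K₀|K)))`** — `K₀ ⊆ K(𝔣(K₀|K))` over a totally complex `K`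
(`le_rayClassField_conductor`) and `θ′` kills `Gal(K̄/K₀)`. [cite: NeukirchANT1999, Ch. VI §6 Def. (6.4) p. 397] -/
theorem apply_eq_one_of_mem_galFixing_rayClassField_conductor [IsTotallyComplex K] (hθ'K₀ : ∀ σ ∈ galFixing K K₀, θ' σ = 1) :
    ∀ σ ∈ galFixing K (rayClassField K (NumberFields.conductor K₀)), θ' σ = 1 :=
  fun σ hσ ↦ hθ'K₀ σ (galFixing_antitone K (le_rayClassField_conductor K₀) hσ)

/-- The same with the fixing subgroup spelled `absGaloisFixingSubgroup` (the binder shape of `JohnsonLeungKings2011.cor53_thm52Shape`).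
[cite: NeukirchANT1999, Ch. VI §6 Def. (6.4) p. 397] [cite: JohnsonLeungKings2011, Cor. 5.3] -/
theorem apply_eq_one_of_mem_absGaloisFixingSubgroup_rayClassField_conductor [IsTotallyComplex K]
    (hθ'K₀ : ∀ σ ∈ galFixing K K₀, θ' σ = 1) :
    ∀ σ ∈ absGaloisFixingSubgroup (rayClassField K (NumberFields.conductor K₀)), θ' σ = 1 := by
  rw [← galFixing_eq_absGaloisFixingSubgroup]
  exact apply_eq_one_of_mem_galFixing_rayClassField_conductor θ' K₀ hθ'K₀

omit [Fact p.Prime] in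
/-- **hCZ's `hK₀` at the conductor: `K₀ ⊆ K(p^s · 𝔣(K₀|K))` for every `s`** (`K₀ ⊆ K(𝔣) ⊆ K(p^s𝔣)`).
[cite: NeukirchANT1999, Ch. VI §6 Def. (6.4) p. 397] [cite: Kato2004Asterisque, §15.1 (p. 250)] -/
theorem le_katoLayer_conductor [Fact p.Prime] [IsTotallyComplex K] (s : ℕ) : K₀ ≤ katoLayer p (NumberFields.conductor K₀) s :=
  (le_rayClassField_conductor K₀).trans (TwistedZeta.rayClassField_le_katoLayer p (NumberFields.conductor K₀) (conductor_ne_bot K₀) s)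

end General

/-! ## §2. The package on the class frame -/

section ClassFrame

variable {K : Type} [Field K] [NumberField K]

/-- **THE IDEAL OF RECORD ON THE CLASS FRAME.** `K` imaginary quadratic, `θ` quadratic, `K₀ = K_θ := K̄^{ker unitChar θ}` (finite abelian), `𝔣 := 𝔣(K₀|K)`:
`𝔣 ≠ 0`; ROW 2's `hNK₀` and `hram0` (in the `≠ 1` and in the `= −1` form) for `θ′ = unitChar θ` at `p = 2`; `K₀ ⊆ K(𝔣)`, `θ′` trivial on
`absGaloisFixingSubgroup (K(𝔣))` (F1's `hθ𝔣`); `K₀ ⊆ K(2^s 𝔣)` for all `s` (hCZ's `hK₀`); and `u ∣ 𝔣 ↔ θ′|_{I_u} ≠ 1`.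
[cite: NeukirchANT1999, Ch. VI §6 (6.4)–(6.6)] [cite: JohnsonLeungKings2011, §4 Lemma 4.3, Cor. 5.3] -/
theorem conductor_frame_of_class (hK : IsImaginaryQuadratic K) (θ : FramedGaloisRep K (padicCoeffIntegers (∅ : Set (PadicAlgCl 2))) 1)
    (hθ2 : ∀ σ : absoluteGaloisGroup K, θ σ ^ 2 = 1) (K₀ : IntermediateField K (AlgebraicClosure K))
    (hK₀ : K₀ = fixedField ((((unitChar θ).toMonoidHom.ker : Subgroup (absoluteGaloisGroup K)).map
      (absoluteGaloisGroup.toAlgEquiv K).toMonoidHom)))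
    [NumberField K₀] [FiniteDimensional K K₀] [IsAbelianGalois K K₀] :
    NumberFields.conductor K₀ ≠ ⊥ ∧
      ramificationSubgroup K (JohnsonLeungKings2011.suppPF 2 (NumberFields.conductor K₀)) ≤ galFixing K K₀ ∧
      (∀ u ∈ JohnsonLeungKings2011.suppPF 2 (NumberFields.conductor K₀), ((2 : ℕ) : 𝓞 K) ∉ u.asIdeal →
        ∃ δ₀ ∈ inertia u, unitChar θ δ₀ ≠ 1) ∧
      (∀ u ∈ JohnsonLeungKings2011.suppPF 2 (NumberFields.conductor K₀), ((2 : ℕ) : 𝓞 K) ∉ u.asIdeal →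
        ∃ δ₀ ∈ inertia u, unitChar θ δ₀ = -1) ∧
      K₀ ≤ rayClassField K (NumberFields.conductor K₀) ∧
      (∀ σ ∈ absGaloisFixingSubgroup (rayClassField K (NumberFields.conductor K₀)), unitChar θ σ = 1) ∧
      (∀ s : ℕ, K₀ ≤ katoLayer 2 (NumberFields.conductor K₀) s) ∧
      (∀ u : HeightOneSpectrum (𝓞 K), u.asIdeal ∣ NumberFields.conductor K₀ ↔ ∃ δ ∈ inertia u, unitChar θ δ ≠ 1) := by
  haveI : Fact (Nat.Prime 2) := ⟨Nat.prime_two⟩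
  haveI : IsTotallyComplex K := IsImaginaryQuadratic.isTotallyComplex hK
  have hθ'K₀ : ∀ σ ∈ galFixing K K₀, unitChar θ σ = 1 := fun σ hσ ↦ by
    subst hK₀
    exact (SelmerPairingFrame.mem_galFixing_fixedField_ker_unitChar_iff θ hθ2 σ).mp hσ
  have hG₀ : ∀ σ : absoluteGaloisGroup K, unitChar θ σ = 1 → σ ∈ galFixing K K₀ := fun σ hσ ↦ by
    subst hK₀
    exact (SelmerPairingFrame.mem_galFixing_fixedField_ker_unitChar_iff θ hθ2 σ).mpr hσ
  have hval : ∀ σ : absoluteGaloisGroup K, unitChar θ σ = 1 ∨ unitChar θ σ = -1 := KummerUDict.unitChar_eq_one_or_eq_neg_one θ hθ2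
  have hram0 := exists_mem_inertia_apply_ne_one_of_mem_suppPF_conductor (unitChar θ) K₀ hθ'K₀ hG₀
  refine ⟨conductor_ne_bot K₀, ramificationSubgroup_suppPF_conductor_le_galFixing (unitChar θ) K₀ hθ'K₀ hG₀, hram0, fun u hu hup ↦ ?_,
    le_rayClassField_conductor K₀, apply_eq_one_of_mem_absGaloisFixingSubgroup_rayClassField_conductor (unitChar θ) K₀ hθ'K₀,
    le_katoLayer_conductor K₀, dvd_conductor_iff_exists_mem_inertia_apply_ne_one (unitChar θ) K₀ hθ'K₀ hG₀⟩
  obtain ⟨δ₀, hδ₀, hne⟩ := hram0 u hu hup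
  exact ⟨δ₀, hδ₀, (hval δ₀).resolve_left hne⟩

end ClassFrame

end Summit.BirchSwinnertonDyer.BirchSwinnertonDyer.Theorems.PrintCf2.ConductorOfRecord

end
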